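import Mathlib
import HarnessLib
import Summits.HubbardSuperconductivity.HubbardSuperconductivity.Theorems.KLProgrammeKLRegimeVolumeLimitSiteKernelDecay

/-!
# VL children from PER-SITE, PER-LABEL data, I: a fixed box inside every large torus, and the spatial truncation
# «per-site ε-comparability ⇒ per-label nested same-momentum ε-comparability» of the cutoff-free carrier
# (seat hubbard-kl-k3c5-p3 g7, technique «OS-positivity-free direct assembly»; `--supports` the VL child stmt-HubbardSuperconductivity-20239)

Route `KLProgramme`, crux K3 `KLRegimeTwoPointLimit`, child VOLUME-LIMIT (`VolumeLimitP2 Pr FinalTwoLegVolLimitEx W`; gen 6: stmt-…-20239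
`KLRegimeVolumeLimitV16`, skeleton «cauchy v6», ONE stub `stub_vl_nested` = the nested same-point export (N)).  The doors of this lineage already take (N)
one Matsubara label at a time with label-dependent rates and thresholds (`volumeLimitP2_of_perLabelThresholdsOnlyText`, p512141) or in position space
(`volumeLimitP2_of_sitePeriodisationOnlyText`).  This file and its sequel (…VolumeLimitPerSiteDoors) remove the last uniformity: the SPATIAL one.  Because
the site kernel of the cutoff-free bare carrier decays like `U²·c·e^{−γ‖y‖_𝕋}` UNIFORMLY in the volume and the label
(`norm_siteKernel_klSelfEnergyInf_zero_le`, p515940), only the finitely many lattice offsets of a fixed box matter for a two-volume comparison, and the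
wrap-around of the nested torus never enters.  Hence (sequel) the VL child closes from

  (PS) for EACH Matsubara integer `n` and EACH lattice offset `z ∈ ℤ²`: the complex numbers
       `h_L(n,z) := torusFourierInv (Σ∞⁰_L(n,·)) (Torus.proj L z)` are comparable across nested volumes beyond a threshold `L₁(n,z,ε)` —
  one scalar sequence at a time, NO norm, NO `ℓ¹`/momentum uniformity, NO modulus, NO rate; a fortiori from plain `L → ∞` LIMITS of each `h_L(n,z)`.

This is BGM 2006's «the limit `L → ∞` of each term exists» ((2.38), Lemma 2.4): dominated convergence term by term plus Tannery — no two-volume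
cluster/decoupling pass is asked of the engine lineage.

* §1 `exists_rate_of_forall_eps` — `ε`-thresholds ⇒ one null rate (diagonal window); `norm_torusFourierInv_sub_le` (the inverse transform is an average).
* §2 torus geometry of a fixed box: `Torus.proj L` is injective on `box d R` once `2R < L`, characters there are the `L`-INDEPENDENT plane waves `e^{ip·z}`
  (`torusChar_proj_of_mem_box`), sites off the image of the box are far (`le_torusNorm_of_not_mem_image`), and an exponentially decaying site function has
  off-box mass `≤ c·S_γ/R` uniformly in the side (`sum_norm_offBox_le_of_decay`).
* §3 **`nestedInf_eps_of_perSite_eps`** — (PS) ⇒ for each label `n`: nested same-momentum `ε`-comparability of `klSelfEnergyInf L β U μ 0 n` beyond `L₁(n,ε)`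
  (every real `U ≠ 0`, `β > 0`).

Everything is proved; no definition; nothing is asserted about the model.
-/

noncomputable section

namespace Summit.HubbardSuperconductivity.HubbardSuperconductivity.Theorems.TwoPointAssembly

set_option linter.dupNamespace false -- summit = problem name (single-conjunct summit), D-0017

open scoped ComplexConjugate
open Finset Filter Topology Literature.MathematicalPhysics.QuantumLattice Literature.Probability.LatticeModels
open Literature.MathematicalPhysics.QuantumLattice.FermiRG
open Summit.HubbardSuperconductivity.HubbardSuperconductivity.Theorems.DispersionFlow
open Summit.HubbardSuperconductivity.HubbardSuperconductivity.Theorems.KLRegimeSplit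
open Summit.HubbardSuperconductivity.HubbardSuperconductivity.Theorems.KLProgrammeLegKernels
open Summit.HubbardSuperconductivity.HubbardSuperconductivity.Theorems.ThermalGreen (sum_torusDist_mul_exp_le natAbs_cRepZ_le_torusNorm)

/-! ## §1 Generic tools -/

/-- **Diagonal rate.**  A property `P L ε` that holds with some value `B` at every `L` and, for every `ε > 0`, beyond an `ε`-dependent threshold,
holds with ONE null sequence `ρ L → 0` in place of `ε` (`ρ` takes the values `B` and `1/(m+1)` only; no monotonicity in `ε` is needed). [folklore] -/
theorem exists_rate_of_forall_eps {P : ℕ → ℝ → Prop} {B : ℝ} (hB : ∀ L, P L B)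
    (h : ∀ ε > (0 : ℝ), ∃ L₁ : ℕ, ∀ L, L₁ ≤ L → P L ε) :
    ∃ ρ : ℕ → ℝ, Tendsto ρ atTop (𝓝 0) ∧ ∀ L, P L (ρ L) := by
  classical
  choose L₁ hL₁ using fun m : ℕ => h (1 / ((m : ℝ) + 1)) (by positivity)
  -- monotone thresholds `T m = max_{j ≤ m} L₁ j`
  set T : ℕ → ℕ := fun m => (Finset.range (m + 1)).sup L₁ with hT
  have hTL : ∀ m, L₁ m ≤ T m := fun m => Finset.le_sup (f := L₁) (Finset.self_mem_range_succ m)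
  -- the window `N L` = the largest `m ≤ L` with `T m ≤ L`
  set N : ℕ → ℕ := fun L => Nat.findGreatest (fun m => T m ≤ L) L with hN
  refine ⟨fun L => if T 0 ≤ L then 1 / ((N L : ℝ) + 1) else B, ?_, fun L => ?_⟩
  · have hNge : ∀ m₀ : ℕ, ∀ᶠ L in atTop, m₀ ≤ N L := fun m₀ => by
      filter_upwards [eventually_ge_atTop (max (T m₀) m₀)] with L hL
      exact Nat.le_findGreatest ((le_max_right _ _).trans hL) ((le_max_left _ _).trans hL)
    refine Metric.tendsto_atTop.2 fun ε hε => ?_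
    obtain ⟨m₀, hm₀⟩ := exists_nat_one_div_lt hε
    obtain ⟨L₂, hL₂⟩ := eventually_atTop.1 (hNge m₀)
    refine ⟨max L₂ (T 0), fun L hL => ?_⟩
    have hT0 : T 0 ≤ L := (le_max_right _ _).trans hL
    have hm : m₀ ≤ N L := hL₂ L ((le_max_left _ _).trans hL)
    rw [if_pos hT0, Real.dist_eq, sub_zero, abs_of_pos (by positivity)]
    have hmono' : 1 / ((N L : ℝ) + 1) ≤ 1 / ((m₀ : ℝ) + 1) := by
      apply one_div_le_one_div_of_le (by positivity)
      exact_mod_cast Nat.succ_le_succ hm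
    exact lt_of_le_of_lt hmono' hm₀
  · show P L (if T 0 ≤ L then 1 / ((N L : ℝ) + 1) else B)
    by_cases hT0 : T 0 ≤ L
    · rw [if_pos hT0]
      have hspec : T (N L) ≤ L := Nat.findGreatest_spec (P := fun m => T m ≤ L) (Nat.zero_le L) hT0
      exact hL₁ (N L) L ((hTL _).trans hspec)
    · rw [if_neg hT0]
      exact hB L

/-- The inverse torus Fourier transform is an average: pointwise `ε`-closeness of two symbols gives `ε`-closeness of their site functions. [folklore] -/
theorem norm_torusFourierInv_sub_le {d L : ℕ} [NeZero L] {f g : TorusSite d L → ℂ} {ε : ℝ} (h : ∀ p, ‖f p - g p‖ ≤ ε) (y : TorusSite d L) :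
    ‖torusFourierInv f y - torusFourierInv g y‖ ≤ ε := by
  rw [torusFourierInv_eq_sum_torusChar, torusFourierInv_eq_sum_torusChar, ← mul_sub, ← Finset.sum_sub_distrib, norm_mul, norm_inv, norm_pow,
    Complex.norm_natCast]
  have hLpos : (0 : ℝ) < L := Nat.cast_pos.mpr (Nat.pos_of_ne_zero (NeZero.ne L))
  have hcard : (Fintype.card (TorusSite d L) : ℝ) = (L : ℝ) ^ d := by
    rw [Fintype.card_fun, ZMod.card, Fintype.card_fin]; push_cast; ring
  have hsum : ‖∑ p : TorusSite d L, (f p * torusChar p y - g p * torusChar p y)‖ ≤ (L : ℝ) ^ d * ε := by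
    refine (norm_sum_le _ _).trans ?_
    calc ∑ p : TorusSite d L, ‖f p * torusChar p y - g p * torusChar p y‖ ≤ ∑ _p : TorusSite d L, ε :=
          Finset.sum_le_sum fun p _ => by rw [← sub_mul, norm_mul, norm_torusChar, mul_one]; exact h p
      _ = (L : ℝ) ^ d * ε := by rw [Finset.sum_const, Finset.card_univ, nsmul_eq_mul, hcard]
  calc ((L : ℝ) ^ d)⁻¹ * ‖∑ p : TorusSite d L, (f p * torusChar p y - g p * torusChar p y)‖
      ≤ ((L : ℝ) ^ d)⁻¹ * ((L : ℝ) ^ d * ε) := mul_le_mul_of_nonneg_left hsum (by positivity)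
    _ = ε := by field_simp

/-! ## §2 A fixed box inside every large torus -/

section Box

variable {d L : ℕ} [NeZero L]

/-- `Torus.proj L` is injective on the centred box `Λ_R` once `2R < L`. [folklore] -/
theorem proj_injOn_box {R : ℕ} (h : 2 * R < L) :
    ∀ x ∈ box d R, ∀ y ∈ box d R, Torus.proj L x = Torus.proj L y → x = y := fun x hx y hy hxy => by
  rw [← Torus.cRep_proj_of_mem_box h hx, ← Torus.cRep_proj_of_mem_box h hy, hxy]

/-- On the box (`2R < L`) the centred representative of `proj z` is `z` itself, coordinatewise. [folklore] -/
theorem cRepZ_proj_of_mem_box {R : ℕ} (h : 2 * R < L) {z : Site d} (hz : z ∈ box d R) (i : Fin d) :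
    Torus.cRepZ (Torus.proj L z i) = z i := by
  have := congrFun (Torus.cRep_proj_of_mem_box h hz) i
  simpa [Torus.cRep] using this

/-- **On the box the characters are the `L`-independent plane waves**: `χ_k(proj_L z) = exp(i p_k·z)` for `z ∈ Λ_R`, `2R < L`. [folklore] -/
theorem torusChar_proj_of_mem_box {R : ℕ} (h : 2 * R < L) {z : Site d} (hz : z ∈ box d R) (k : TorusSite d L) :
    torusChar k (Torus.proj L z) = Complex.exp (Complex.I * ((∑ i, latticeMomentum L k i * (z i : ℝ) : ℝ) : ℂ)) := by
  rw [torusChar_eq_exp_cRepZ]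
  simp_rw [cRepZ_proj_of_mem_box h hz]

/-- A torus site of torus norm `≤ R` is the projection of a point of the box `Λ_R` (its centred lift). [folklore] -/
theorem mem_image_proj_box_of_torusNorm_le {R : ℕ} {y : TorusSite d L} (hy : torusNorm y ≤ R) :
    y ∈ (box d R).image (Torus.proj L) := by
  classical
  refine Finset.mem_image.2 ⟨Torus.cRep y, ?_, Torus.proj_cRep y⟩
  rw [mem_box]
  intro i
  have h : (Torus.cRepZ (y i)).natAbs ≤ R := (natAbs_cRepZ_le_torusNorm y i).trans hy
  change -(R : ℤ) ≤ Torus.cRepZ (y i) ∧ Torus.cRepZ (y i) ≤ R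
  omega

/-- Hence a site OFF the image of the box is far from the origin: `R + 1 ≤ ‖y‖_𝕋`, in particular `y ≠ 0`. [folklore] -/
theorem le_torusNorm_of_not_mem_image {R : ℕ} {y : TorusSite d L} (hy : y ∉ (box d R).image (Torus.proj L)) :
    R + 1 ≤ torusNorm y := by
  by_contra h
  exact hy (mem_image_proj_box_of_torusNorm_le (by omega))

omit [NeZero L] in
/-- The origin lies in the image of every box. [folklore] -/
theorem zero_mem_image_proj_box (R : ℕ) : (0 : TorusSite d L) ∈ (box d R).image (Torus.proj L) := by
  classical
  refine Finset.mem_image.2 ⟨0, ?_, ?_⟩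
  · rw [mem_box]; intro i; simp
  · funext i; simp [Torus.proj_apply]

/-- **Off-box mass of an exponentially decaying site function**: if `‖g y‖ ≤ c·e^{−γ‖y‖_𝕋}` off the origin (`c ≥ 0`, `γ > 0`), then for `R ≥ 1`
`Σ_{y ∉ proj(Λ_R)} ‖g y‖ ≤ c·S_γ/R`, `S_γ = Σ'_r 4(2r+1)·r·e^{−γr}` — uniformly in the side `L` (first-moment trick `1 ≤ ‖y‖_𝕋/R` on the tail and the
radial lattice sum `sum_torusDist_mul_exp_le`). [folklore] -/
theorem sum_norm_offBox_le_of_decay {L : ℕ} [NeZero L] {g : TorusSite 2 L → ℂ} {c γ : ℝ} (hc : 0 ≤ c) (hγ : 0 < γ)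
    (hg : ∀ y : TorusSite 2 L, y ≠ 0 → ‖g y‖ ≤ c * Real.exp (-(γ * (torusNorm y : ℝ)))) {R : ℕ} (hR : 1 ≤ R) :
    ∑ y ∈ ((box 2 R).image (Torus.proj L))ᶜ, ‖g y‖ ≤
      c * (∑' r : ℕ, (4 * (2 * (r : ℝ) + 1)) * ((r : ℝ) * Real.exp (-(γ * r)))) / R := by
  classical
  set A : Finset (TorusSite 2 L) := (box 2 R).image (Torus.proj L) with hA
  set S : ℝ := ∑' r : ℕ, (4 * (2 * (r : ℝ) + 1)) * ((r : ℝ) * Real.exp (-(γ * r))) with hS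
  have hRpos : (0 : ℝ) < R := by exact_mod_cast hR
  have hnorm : ∀ y : TorusSite 2 L, (torusDist y (0 : TorusSite 2 L) : ℝ) = (torusNorm y : ℝ) := by
    intro y; rw [torusDist, sub_zero]
  -- termwise on the tail: `‖g y‖ ≤ (c/R)·‖y‖·e^{−γ‖y‖}`
  have hterm : ∀ y ∈ Aᶜ, ‖g y‖ ≤ c / R * ((torusDist y (0 : TorusSite 2 L) : ℝ) * Real.exp (-(γ * torusDist y (0 : TorusSite 2 L)))) := by
    intro y hy
    rw [Finset.mem_compl] at hy
    have hfar : R + 1 ≤ torusNorm y := le_torusNorm_of_not_mem_image hy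
    have hy0 : y ≠ 0 := fun h0 => hy (h0 ▸ zero_mem_image_proj_box R)
    have hN : (R : ℝ) ≤ (torusNorm y : ℝ) := by exact_mod_cast (Nat.le_succ R).trans hfar
    have hratio : (1 : ℝ) ≤ (torusNorm y : ℝ) / R := by rwa [le_div_iff₀ hRpos, one_mul]
    rw [hnorm]
    calc ‖g y‖ ≤ c * Real.exp (-(γ * (torusNorm y : ℝ))) := hg y hy0
      _ ≤ c * Real.exp (-(γ * (torusNorm y : ℝ))) * ((torusNorm y : ℝ) / R) := le_mul_of_one_le_right (by positivity) hratio
      _ = c / R * ((torusNorm y : ℝ) * Real.exp (-(γ * (torusNorm y : ℝ)))) := by ring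
  calc ∑ y ∈ Aᶜ, ‖g y‖ ≤ ∑ y ∈ Aᶜ, c / R * ((torusDist y (0 : TorusSite 2 L) : ℝ) * Real.exp (-(γ * torusDist y (0 : TorusSite 2 L)))) :=
        Finset.sum_le_sum hterm
    _ ≤ ∑ y, c / R * ((torusDist y (0 : TorusSite 2 L) : ℝ) * Real.exp (-(γ * torusDist y (0 : TorusSite 2 L)))) :=
        Finset.sum_le_univ_sum_of_nonneg fun y => by positivity
    _ = c / R * ∑ y, (torusDist y (0 : TorusSite 2 L) : ℝ) * Real.exp (-(γ * torusDist y (0 : TorusSite 2 L))) := by rw [Finset.mul_sum]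
    _ ≤ c / R * S := mul_le_mul_of_nonneg_left (sum_torusDist_mul_exp_le hγ 0) (by positivity)
    _ = c * S / R := by ring

end Box

/-! ## §3 Per-site comparability ⇒ per-label nested same-momentum comparability (cutoff-free) -/

section PerSite

variable {β U : ℝ}

/-- **(PS) ⇒ (N) per label, cutoff-free, ε-form.**  If for EACH lattice offset `z ∈ ℤ²` the site-kernel values
`torusFourierInv (Σ∞⁰_L(n,·)) (proj_L z)` are `ε`-comparable across nested volumes beyond a threshold `L₁(z,ε)`, then the cutoff-free bare carrier at the
Matsubara integer `n` is `ε`-comparable across nested volumes at equal momenta beyond a threshold `L₁(ε)` (all momenta at once).  Mechanism: Fourier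
representation on each torus; on a box `Λ_R` with `2R < L ≤ L″` the characters of both tori are the same plane waves (`torusChar_proj_of_mem_box`), so
the box parts differ by at most `|Λ_R|·` the per-site tolerance; both off-box parts are `≤ U²c·S_γ/R` by the volume- and label-uniform site decay
`norm_siteKernel_klSelfEnergyInf_zero_le` — choose `R` first, then the per-site thresholds on the finite box. -/
theorem nestedInf_eps_of_perSite_eps (hβ : 0 < β) (hU : U ≠ 0) (μ : ℝ) (n : ℤ)
    (h : ∀ z : Site 2, ∀ ε > (0 : ℝ), ∃ L₁ : ℕ, ∀ (L : ℕ) [NeZero L], L₁ ≤ L → ∀ (L'' : ℕ) [NeZero L''], L ∣ L'' →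
      ‖torusFourierInv (fun p : TorusSite 2 L => klSelfEnergyInf L β U μ 0 n p) (Torus.proj L z) -
        torusFourierInv (fun p : TorusSite 2 L'' => klSelfEnergyInf L'' β U μ 0 n p) (Torus.proj L'' z)‖ ≤ ε) :
    ∀ ε > (0 : ℝ), ∃ L₁ : ℕ, ∀ (L : ℕ) [NeZero L], L₁ ≤ L → ∀ (L'' : ℕ) [NeZero L''], L ∣ L'' →
      ∀ (k : TorusSite 2 L) (k'' : TorusSite 2 L''), latticeMomentum L'' k'' = latticeMomentum L k →
        ‖klSelfEnergyInf L β U μ 0 n k - klSelfEnergyInf L'' β U μ 0 n k''‖ ≤ ε := by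
  classical
  intro ε hε
  -- the decay constants of `norm_siteKernel_klSelfEnergyInf_zero_le`
  set κ : ℝ := Real.exp 1 * (2 * (2 * |(1 : ℝ)| + |U| + 2 * |μ + U / 2|) * (2 * (2 * 4 + 1) : ℕ)) with hκ
  have hJpos : 0 < 2 * |(1 : ℝ)| + |U| + 2 * |μ + U / 2| := by
    have h1 : |(1 : ℝ)| = 1 := abs_one
    have := abs_nonneg U; have := abs_nonneg (μ + U / 2); linarith
  have hκpos : 0 < κ := by positivity
  set γ : ℝ := min (1 / 2 : ℝ) (Real.pi / (8 * κ * β)) with hγ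
  have hγpos : 0 < γ := lt_min (by norm_num) (by positivity)
  set c : ℝ := U ^ 2 * ((3 / 2) * (3 / 2) * (5 * β / Real.pi)) with hc
  have hc0 : 0 ≤ c := by positivity
  set S : ℝ := ∑' r : ℕ, (4 * (2 * (r : ℝ) + 1)) * ((r : ℝ) * Real.exp (-(γ * r))) with hS
  have hS0 : 0 ≤ S := tsum_nonneg fun r => by positivity
  -- the box radius: `c·S/R ≤ ε/4`
  obtain ⟨R₀, hR₀⟩ := exists_nat_ge (4 * (c * S) / ε)
  set R : ℕ := max R₀ 1 with hR
  have hR1 : 1 ≤ R := le_max_right _ _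
  have hRpos : (0 : ℝ) < R := by exact_mod_cast hR1
  have htail : c * S / R ≤ ε / 4 := by
    rw [div_le_iff₀ hRpos]
    have hR₀' : 4 * (c * S) / ε ≤ R := hR₀.trans (by exact_mod_cast le_max_left R₀ 1)
    rw [div_le_iff₀ hε] at hR₀'
    linarith
  -- per-site thresholds on the box
  set Bx : Finset (Site 2) := box 2 R with hBx
  have hBx0 : (0 : Site 2) ∈ Bx := by rw [hBx, mem_box]; intro i; simp
  have hcardpos : (0 : ℝ) < Bx.card := by exact_mod_cast Finset.card_pos.2 ⟨0, hBx0⟩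
  set ε' : ℝ := ε / (2 * Bx.card) with hε'
  have hε'pos : 0 < ε' := by positivity
  choose L₁ hL₁ using fun z : Site 2 => h z ε' hε'pos
  refine ⟨max (Bx.sup L₁) (2 * R + 1), fun L _ hL L'' _ hdvd k k'' hkk => ?_⟩
  have h2R : 2 * R < L := lt_of_lt_of_le (Nat.lt_succ_self _) ((le_max_right _ _).trans hL)
  have hLL'' : L ≤ L'' := Nat.le_of_dvd (Nat.pos_of_ne_zero (NeZero.ne L'')) hdvd
  have h2R'' : 2 * R < L'' := lt_of_lt_of_le h2R hLL''
  have hL3 : 3 ≤ L := by omega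
  have hL3'' : 3 ≤ L'' := hL3.trans hLL''
  -- the two site kernels and the Fourier representations of the carrier
  set gL : TorusSite 2 L → ℂ := torusFourierInv (fun p : TorusSite 2 L => klSelfEnergyInf L β U μ 0 n p) with hgL
  set gL'' : TorusSite 2 L'' → ℂ := torusFourierInv (fun p : TorusSite 2 L'' => klSelfEnergyInf L'' β U μ 0 n p) with hgL''
  have hrep : klSelfEnergyInf L β U μ 0 n k = ∑ y, gL y * conj (torusChar k y) := by
    rw [eq_torusFourier_torusFourierInv (fun p : TorusSite 2 L => klSelfEnergyInf L β U μ 0 n p) k, torusFourier_eq_sum_torusChar]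
  have hrep'' : klSelfEnergyInf L'' β U μ 0 n k'' = ∑ y, gL'' y * conj (torusChar k'' y) := by
    rw [eq_torusFourier_torusFourierInv (fun p : TorusSite 2 L'' => klSelfEnergyInf L'' β U μ 0 n p) k'', torusFourier_eq_sum_torusChar]
  -- the common plane wave on the box
  set e : Site 2 → ℂ := fun z => Complex.exp (Complex.I * ((∑ i, latticeMomentum L k i * (z i : ℝ) : ℝ) : ℂ)) with he
  have hnorm_e : ∀ z, ‖conj (e z)‖ = 1 := by
    intro z
    rw [RCLike.norm_conj, he]
    exact Complex.norm_exp_ofReal_mul_I _ ▸ by rw [mul_comm]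
  set A : Finset (TorusSite 2 L) := Bx.image (Torus.proj L) with hA
  set A'' : Finset (TorusSite 2 L'') := Bx.image (Torus.proj L'') with hA''
  have hbox : ∑ y ∈ A, gL y * conj (torusChar k y) = ∑ z ∈ Bx, gL (Torus.proj L z) * conj (e z) := by
    rw [hA, Finset.sum_image (proj_injOn_box h2R)]
    refine Finset.sum_congr rfl fun z hz => ?_
    rw [torusChar_proj_of_mem_box h2R hz]
  have hbox'' : ∑ y ∈ A'', gL'' y * conj (torusChar k'' y) = ∑ z ∈ Bx, gL'' (Torus.proj L'' z) * conj (e z) := by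
    rw [hA'', Finset.sum_image (proj_injOn_box h2R'')]
    refine Finset.sum_congr rfl fun z hz => ?_
    rw [torusChar_proj_of_mem_box h2R'' hz, hkk]
  -- the box parts differ by at most `|Λ_R|·ε'`
  have hboxdiff : ‖∑ z ∈ Bx, gL (Torus.proj L z) * conj (e z) - ∑ z ∈ Bx, gL'' (Torus.proj L'' z) * conj (e z)‖ ≤ ε / 2 := by
    rw [← Finset.sum_sub_distrib]
    refine (norm_sum_le _ _).trans ?_
    calc ∑ z ∈ Bx, ‖gL (Torus.proj L z) * conj (e z) - gL'' (Torus.proj L'' z) * conj (e z)‖ ≤ ∑ _z ∈ Bx, ε' :=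
          Finset.sum_le_sum fun z _ => by
            rw [← sub_mul, norm_mul, hnorm_e, mul_one]
            exact hL₁ z L ((Finset.le_sup (f := L₁) (by simpa [hBx] using ‹z ∈ Bx›)).trans ((le_max_left _ _).trans hL)) L'' hdvd
      _ = Bx.card * ε' := by rw [Finset.sum_const, nsmul_eq_mul]
      _ = ε / 2 := by rw [hε']; field_simp
  -- the off-box parts are small by the uniform site decay
  have hdecL : ∀ y : TorusSite 2 L, y ≠ 0 → ‖gL y‖ ≤ c * Real.exp (-(γ * (torusNorm y : ℝ))) := fun y hy => by
    have := norm_siteKernel_klSelfEnergyInf_zero_le hL3 hβ hU μ n hy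
    rw [hgL, hc, hγ, hκ]
    simpa only [mul_assoc] using this
  have hdecL'' : ∀ y : TorusSite 2 L'', y ≠ 0 → ‖gL'' y‖ ≤ c * Real.exp (-(γ * (torusNorm y : ℝ))) := fun y hy => by
    have := norm_siteKernel_klSelfEnergyInf_zero_le hL3'' hβ hU μ n hy
    rw [hgL'', hc, hγ, hκ]
    simpa only [mul_assoc] using this
  have htailL : ‖∑ y ∈ Aᶜ, gL y * conj (torusChar k y)‖ ≤ ε / 4 := by
    refine (norm_sum_le _ _).trans ?_
    calc ∑ y ∈ Aᶜ, ‖gL y * conj (torusChar k y)‖ = ∑ y ∈ Aᶜ, ‖gL y‖ :=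
          Finset.sum_congr rfl fun y _ => by rw [norm_mul, RCLike.norm_conj, norm_torusChar, mul_one]
      _ ≤ c * S / R := sum_norm_offBox_le_of_decay hc0 hγpos hdecL hR1
      _ ≤ ε / 4 := htail
  have htailL'' : ‖∑ y ∈ A''ᶜ, gL'' y * conj (torusChar k'' y)‖ ≤ ε / 4 := by
    refine (norm_sum_le _ _).trans ?_
    calc ∑ y ∈ A''ᶜ, ‖gL'' y * conj (torusChar k'' y)‖ = ∑ y ∈ A''ᶜ, ‖gL'' y‖ :=
          Finset.sum_congr rfl fun y _ => by rw [norm_mul, RCLike.norm_conj, norm_torusChar, mul_one]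
      _ ≤ c * S / R := sum_norm_offBox_le_of_decay hc0 hγpos hdecL'' hR1
      _ ≤ ε / 4 := htail
  -- assemble
  rw [hrep, hrep'', ← Finset.sum_add_sum_compl A, ← Finset.sum_add_sum_compl A'', hbox, hbox'']
  calc ‖∑ z ∈ Bx, gL (Torus.proj L z) * conj (e z) + ∑ y ∈ Aᶜ, gL y * conj (torusChar k y) -
        (∑ z ∈ Bx, gL'' (Torus.proj L'' z) * conj (e z) + ∑ y ∈ A''ᶜ, gL'' y * conj (torusChar k'' y))‖
      = ‖(∑ z ∈ Bx, gL (Torus.proj L z) * conj (e z) - ∑ z ∈ Bx, gL'' (Torus.proj L'' z) * conj (e z)) +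
          ∑ y ∈ Aᶜ, gL y * conj (torusChar k y) - ∑ y ∈ A''ᶜ, gL'' y * conj (torusChar k'' y)‖ := by ring_nf
    _ ≤ ‖∑ z ∈ Bx, gL (Torus.proj L z) * conj (e z) - ∑ z ∈ Bx, gL'' (Torus.proj L'' z) * conj (e z)‖ +
          ‖∑ y ∈ Aᶜ, gL y * conj (torusChar k y)‖ + ‖∑ y ∈ A''ᶜ, gL'' y * conj (torusChar k'' y)‖ := norm_sub_le_of_le (norm_add_le _ _) le_rfl
    _ ≤ ε / 2 + ε / 4 + ε / 4 := by gcongr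
    _ = ε := by ring

end PerSite

end Summit.HubbardSuperconductivity.HubbardSuperconductivity.Theorems.TwoPointAssembly

end
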